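import Literature.IUT.HodgeArakelov.ThetaEvaluationSettingModelOfProp15Over
import Literature.IUT.HodgeArakelov.EtaleThetaDataSignOfFacts
import Literature.AnabelianGeometry.EtaleTheta.Discharge.Sec1LogUddNotKummer

/-!
# [IUTchII] Prop 2.2 (ii)′ at the MODEL on the [EtTh] §1 NAMED-FACT route — binder `hL` (GAP G-L2t1-1) DISCHARGED
# (node IUTchII:Prop2.2(ii); GAP row G-w4d010-2 residual (R3), dispositions D-G-w4d010-2g; G-L2t1-1 «DERIVED»)

S. Mochizuki, *Inter-universal Teichmüller theory II*, kurims manuscript (Dec. 2020) §2, Prop. 2.2 (ii) p. 66 l. 55–61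
(«the condition of invariance with respect to `ι` … determines a specific `μ_{2l}`-orbit»; claim key `Mochizuki2012`,
DISPUTED, D-0012); S. Mochizuki, *The étale theta function …* [EtTh], Publ. RIMS **45** (2009) (refereed): Prop. 1.5
(ii), (iii) PRIMS-render PDF p. 23 («`F̈¹/F̈² = … = Ẑ · log(Ü)`»), Def. 2.7 p. 41; [AbsAnab] Lem. 1.3.8 (FACT-LIST F-0007
`FundamentalExtension.PreservesGeom`).

PROOF-ONLY junction file (cell abc-iut, D-0067 wave 4, seat abc-iut-w4-d010 gen 5 — the node's END-TO-END assembler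
lineage; NO definitions, NO `Prop`-valued facts, nothing landed is edited). Every (R3)-side closer of the
μ_{2l}-clause of [IUTchII] Prop. 2.2 (ii) at the model `D := etaleThetaDataOfSetting'` landed CONDITIONALLY on the
binder `hL : ∀ n : ℤ, log(Ü)ⁿ ∈ F̈² → n = 0` (plan/GAP-LEDGER G-L2t1-1, the untyped half of [EtTh] Prop. 1.5 (ii)'s
«`F̈¹/F̈² = Ẑ · log(Ü)`»):
* abc-iut-L2-t8's `h14free_of_prop15` / `prop22_ii'_model_of_inversion_of_prop15` (`ThetaEvaluationSettingModelOfProp15`)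
  and `not_isOfFinOrder_translate_of_prop15` / `hfree_of_prop15` (`EtaleThetaDataSignOfFacts`);
* this lineage's `prop22_ii'_model_of_hinv_of_prop15` / `…_of_hinv_over_of_prop15` /
  `…_of_hinv_of_preservesGeom_of_prop15` (`ThetaEvaluationSettingModelOfProp15Over`, p425204).
abc-iut-L2-t7's `Sec1LogUddNotKummer` DERIVED `hL` in exactly its typed shape —
`EtaleThetaData.logUdd_zpow_mem_Fdd2_imp (hC : Compat) (hO : IsEtThOrigin) (h15 : Prop15iii E hC)
(h15ii : Prop15ii E.toKummerData hC)` — from four inputs that EVERY one of the seven theorems above already binds.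
This file substitutes the derivation: the seven statements below are the landed ones with the binder `hL` REMOVED and
every other hypothesis byte-identical (suffix `_of_origin`, after abc-iut-L2-t1's `Sec1TranslatesNonTorsionOfOrigin`).

RESULT. On the NAMED-FACT route the μ_{2l}-clause closers of node IUTchII:Prop2.2(ii) are now modulo EXACTLY: the model
inputs (`C`, `hC`, `hS`, (H1) `hchar`, `S`, `eS`, `hl`); the ι-DATUM {`ι`, `hι`, `hΔ` | `a`/`haug` | the F-0007 instance,
`hq`, `δ`/`hιι`, `hinv`} (resp. {`c`, `hZ`, `hβ`} on L2-t8's companion-datum form); ONE deck element `ε` with the ONE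
class-level statement `h14iota`; and the FACT-LIST facts F-2498 `IsEtThOrigin`, F-0591 `Prop15iii`, F-2503 `Prop15ii`
— with NO G-L2t1-1 clause. Honest framing: every input about `ι`, `hq`, `h14iota` and every [EtTh] named fact stays a
hypothesis; F-0007 enters as a named hypothesis at an instance; nothing here bears on [IUTchIII] Cor. 3.12.
[claim: Mochizuki2012, status: disputed] typed ≠ proved.
-/

namespace Literature.IUT.HodgeArakelov

open Literature.AnabelianGeometry.EtaleTheta (ContH1 ThetaSetting)
open Literature.AnabelianGeometry.EtaleTheta Literature.AnabelianGeometry.AbsoluteAnabelian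
open Literature.AnabelianGeometry.SemiGraphs (GQp)
open EtaleThetaDataOfSetting CohomologySystemOfContH1
open _root_.Topology
open scoped commutatorElement

noncomputable section

namespace EtaleThetaDataOfSetting

variable {p : ℕ} [Fact p.Prime] {D : Literature.AnabelianGeometry.EtaleTheta.ThetaSetting p}
  {E : D.EtaleThetaData} {l : ℕ} (C : E.DoubleUnderline l)

/-! ## (R3) at the model from `Prop15ii`, `Prop15iii`, `IsEtThOrigin` — no `hL` -/

/-- **Binder `h14free` of `prop22_ii'_model_of_inversion_of_classLevel` from the named facts `Prop15iii`, `Prop15ii`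
and `IsEtThOrigin` ONLY** — abc-iut-L2-t8's `h14free_of_prop15` with `hL := logUdd_zpow_mem_Fdd2_imp hC hO h15 h15ii`.
[cite: MochizukiEtTh2009, Prop 1.5 (iii) p.23] -/
theorem h14free_of_prop15_of_origin [D.GtpYdd.Normal] (hC : D.Compat) (hO : D.IsEtThOrigin)
    (h15 : ThetaSetting.Prop15iii E hC) (h15ii : ThetaSetting.Prop15ii E.toKummerData hC)
    (γ : Pi C) (hγ : C.toLZ γ = Multiplicative.ofAdd 1) :
    ∀ k : ℤ, k ≠ 0 → ¬ IsOfFinOrder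
      (ContH1.comap D.toTheta D.DeltaTheta C.Huu.subtype continuous_subtype_val
        (map_subtype_piYdd_inf_le_GtpYdd C ⊤)
        (ContH1.conj D.toTheta D.DeltaTheta ((γ : D.PiTemp) ^ k) E.etaDd * E.etaDd⁻¹)) :=
  h14free_of_prop15 C hC hO h15 h15ii (E.logUdd_zpow_mem_Fdd2_imp hC hO h15 h15ii) γ hγ

/-- **The `γᵏ`-translates of the root class are non-torsion** (`k ≠ 0`, `γ` a `toLZ`-generator of `Π^tp_X̲̲`), modulo
the FACTS `Prop15ii`, `Prop15iii` and the freeness guard `IsEtThOrigin` ONLY — abc-iut-L2-t8's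
`not_isOfFinOrder_translate_of_prop15` with `hL` discharged. [cite: MochizukiEtTh2009, Prop 1.5 (iii) p.23] -/
theorem not_isOfFinOrder_translate_of_prop15_of_origin [(PiYdd C).Normal] (hC : D.Compat) (hS : D.Sec2Hyps)
    (hO : D.IsEtThOrigin) (h15 : ThetaSetting.Prop15iii E hC) (h15ii : ThetaSetting.Prop15ii E.toKummerData hC)
    (γ : Pi C) (hγ : C.toLZ γ = Multiplicative.ofAdd 1) (k : ℤ) (hk : k ≠ 0) :
    ¬ IsOfFinOrder (ContH1.conj (phi C) (D.lDeltaTheta l) (γ ^ k) (rootLiftClass C) * (rootLiftClass C)⁻¹) :=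
  not_isOfFinOrder_translate_of_prop15 C hC hS hO h15 h15ii (E.logUdd_zpow_mem_Fdd2_imp hC hO h15 h15ii) γ hγ k hk

/-- **Binder (R3) `hfree` of `prop22_ii'_model` HOLDS at the model** (its exact `h1Top`-translated shape), modulo the
FACTS `Prop15ii`, `Prop15iii` and `IsEtThOrigin` ONLY: distinct `γ`-translates of `η̲̈^Θ` differ by non-torsion classes
— abc-iut-L2-t8's `hfree_of_prop15` with `hL` discharged. [cite: MochizukiEtTh2009, Prop 1.5 (iii) p.23] -/
theorem hfree_of_prop15_of_origin [(PiYdd C).Normal] (hC : D.Compat) (hS : D.Sec2Hyps) (hO : D.IsEtThOrigin)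
    (h15 : ThetaSetting.Prop15iii E hC) (h15ii : ThetaSetting.Prop15ii E.toKummerData hC)
    (γ : Pi C) (hγ : C.toLZ γ = Multiplicative.ofAdd 1) (m n : ℤ)
    (hmn : IsOfFinAddOrder
      ((h1Top C).symm (Additive.ofMul (ContH1.conj (phi C) (D.lDeltaTheta l) (γ ^ m) (rootLiftClass C))) -
        (h1Top C).symm (Additive.ofMul (ContH1.conj (phi C) (D.lDeltaTheta l) (γ ^ n) (rootLiftClass C))))) :
    m = n :=
  hfree_of_prop15 C hC hS hO h15 h15ii (E.logUdd_zpow_mem_Fdd2_imp hC hO h15 h15ii) γ hγ m n hmn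

/-! ## [IUTchII] Prop 2.2 (ii)′ at the model, companion-datum form (abc-iut-L2-t8's p419369) — no `hL` -/

section Companion

variable (ι : D.PiTemp ≃ₜ* D.PiTemp) (hι : C.Huu.map ι.toMulEquiv.toMonoidHom = C.Huu)
  (c : ThetaSetting.ThetaCompanion ι)

/-- **IUTchII:Prop2.2(ii)′ at the model `Π_v := Π^tp_X̲̲`, (R2)-sign and (R3) from the [EtTh] §1 NAMED FACTS, binder
`hL` discharged**: `Prop22_ii' Dec` at `D := etaleThetaDataOfSetting'` for every Prop. 2.2 (i) datum `Dec`, GIVEN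
EXACTLY: the model data (`C`, `hC`, `hS`, (H1) `hchar`, `S`, `eS`, `hl`); the (R1) inversion datum (`ι` with
`ι(Π^tp_X̲̲) = Π^tp_X̲̲`, theta companion `c`, `ℤ`-reversal `hZ` at the `toLZ`-generator `γ`, `ι² = conj δ` on `Π^tp_X̲̲`,
`ι ≡ +1` on `Δ_Θ/l·Δ_Θ`, deck element `ε ∈ Π^tp_Y ∖ Π^tp_Ÿ`); the class-level `ι`-statement `h14iota`; and the named §1
facts `Prop15iii` (F-0591), `Prop15ii` (F-2503) with the freeness guard `IsEtThOrigin` (F-2498) — abc-iut-L2-t8's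
`prop22_ii'_model_of_inversion_of_prop15` with `hL := logUdd_zpow_mem_Fdd2_imp hC hO h15 h15ii`.
[claim: Mochizuki2012, status: disputed] (IUTchII §2 Prop 2.2 (ii), kurims p.66) -/
theorem prop22_ii'_model_of_inversion_of_prop15_of_origin [(PiYdd C).Normal] [D.GtpYdd.Normal]
    (hC : D.Compat) (hS : D.Sec2Hyps) (hchar : PiYddCharacteristic C) (S : BadPlaceSetting.{0})
    (eS : (Pi C) ≃ₜ* S.PiX) (hl : S.l = l) {T₀ : TemperedCoverings S (Pi C)}
    (Dec : SubgraphDecomposition S T₀ (etaleThetaDataOfSetting' C hC hS hchar S.toThetaSetting eS hl))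
    -- (R1) the inversion datum
    (γ ε : Pi C) (hγ : C.toLZ γ = Multiplicative.ofAdd 1) (hε₁ : (ε : D.PiTemp) ∈ D.GtpY)
    (hε₂ : (ε : D.PiTemp) ∉ D.GtpYdd) (hZ : D.toZ (ι (γ : D.PiTemp)) = (D.toZ (γ : D.PiTemp))⁻¹)
    (δ : Pi C) (hιι : ∀ x : Pi C, ι (ι (x : D.PiTemp)) = (δ : D.PiTemp) * (x : D.PiTemp) * (δ : D.PiTemp)⁻¹)
    (hβ : ∀ a : D.GtpTheta, a ∈ D.DeltaTheta → c.thetaIso a * a⁻¹ ∈ D.lDeltaTheta l)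
    -- (R2) the class-level ι-statement ("Θ̈(Ü) = −Θ̈(Ü⁻¹)"), still a binder
    (h14iota : ContH1Aut.autMap (phi C) D.DeltaTheta (inversionAlpha C ι hι) c.thetaIso
        (thetaCompanion_phi C ι hι c) (thetaCompanion_mem_deltaTheta ι c)
        (symm_mem_inf_top (PiYdd C) (inversionAlpha C ι hι) (mem_PiYdd_iff_of_piYddCharacteristic C hchar _))
        (ContH1.comap D.toTheta D.DeltaTheta C.Huu.subtype continuous_subtype_val
          (map_subtype_piYdd_inf_le_GtpYdd C ⊤) E.etaDd) =
      ContH1.conj (phi C) D.DeltaTheta ε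
        (ContH1.comap D.toTheta D.DeltaTheta C.Huu.subtype continuous_subtype_val
          (map_subtype_piYdd_inf_le_GtpYdd C ⊤) E.etaDd))
    -- the [EtTh] §1 named facts (no `hL`)
    (hO : D.IsEtThOrigin) (h15 : ThetaSetting.Prop15iii E hC) (h15ii : ThetaSetting.Prop15ii E.toKummerData hC) :
    Prop22_ii' Dec :=
  prop22_ii'_model_of_inversion_of_prop15 C ι hι c hC hS hchar S eS hl Dec γ ε hγ hε₁ hε₂ hZ δ hιι hβ h14iota hO h15
    h15ii (E.logUdd_zpow_mem_Fdd2_imp hC hO h15 h15ii)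

end Companion

/-! ## [IUTchII] Prop 2.2 (ii)′ at the model, ι-datum reduced (this lineage's p425204) — no `hL` -/

section Inversion

variable (ι : D.PiTemp ≃ₜ* D.PiTemp) (hι : C.Huu.map ι.toMulEquiv.toMonoidHom = C.Huu)
  (hinv : ∀ g ∈ D.toTemperedCurve.DeltaHat, D.toTemperedCurve.completionAut ι g * g ∈
    (⁅D.toTemperedCurve.DeltaHat, D.toTemperedCurve.DeltaHat⁆).topologicalClosure)

include hinv in
/-- **IUTchII:Prop2.2(ii)′ at the model on the [EtTh] §1 NAMED-FACT route, ι-datum reduced, binder `hL` discharged**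
(kurims p. 66): for a topological automorphism `ι` of `Π^tp_X` with `ι(Π^tp_X̲̲) = Π^tp_X̲̲` (`hι`), `ι(Δ^tp_X) = Δ^tp_X`
(`hΔ`), `ι² = conj δ` on `Π^tp_X̲̲` (`hιι`) and `ι̂ ≡ −1` on `Δ_X^ab` (`hinv`), the root-topology input `hq`, a deck
element `ε ∈ Π^tp_Y ∖ Π^tp_Ÿ` with the class-level `ι`-statement `h14iota` at the CONSTRUCTED theta companion
`thetaCompanionOfAut ι hΔ hq`, and the named facts `IsEtThOrigin` (F-2498), `Prop15iii` (F-0591), `Prop15ii` (F-2503)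
ONLY: `Prop22_ii' Dec` — this lineage's `prop22_ii'_model_of_hinv_of_prop15` with
`hL := logUdd_zpow_mem_Fdd2_imp hC hO h15 h15ii`.
[claim: Mochizuki2012, status: disputed] (IUTchII §2 Prop 2.2 (ii), kurims pp.65-67) -/
theorem prop22_ii'_model_of_hinv_of_prop15_of_origin (hΔ : D.DeltaTemp.map ι.toMulEquiv.toMonoidHom = D.DeltaTemp)
    (hq : IsQuotientMap D.toTheta)
    [hN : (PiYdd C).Normal] [hYN : D.GtpYdd.Normal] (hC : D.Compat) (hS : D.Sec2Hyps)
    (hchar : PiYddCharacteristic C) (S : BadPlaceSetting.{0}) (eS : (Pi C) ≃ₜ* S.PiX) (hl : S.l = l)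
    {T₀ : TemperedCoverings S (Pi C)}
    (Dec : SubgraphDecomposition S T₀ (etaleThetaDataOfSetting' C hC hS hchar S.toThetaSetting eS hl))
    -- the deck element and `ι² = conj δ`
    (ε : Pi C) (hε₁ : (ε : D.PiTemp) ∈ D.GtpY) (hε₂ : (ε : D.PiTemp) ∉ D.GtpYdd)
    (δ : Pi C) (hιι : ∀ x : Pi C, ι (ι (x : D.PiTemp)) = (δ : D.PiTemp) * (x : D.PiTemp) * (δ : D.PiTemp)⁻¹)
    -- (R2) the class-level ι-statement ("Θ̈(Ü) = −Θ̈(Ü⁻¹)") at the constructed theta companion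
    (h14iota : ContH1Aut.autMap (phi C) D.DeltaTheta (inversionAlpha C ι hι) (D.thetaCompanionOfAut ι hΔ hq).thetaIso
        (thetaCompanion_phi C ι hι (D.thetaCompanionOfAut ι hΔ hq))
        (thetaCompanion_mem_deltaTheta ι (D.thetaCompanionOfAut ι hΔ hq))
        (symm_mem_inf_top (PiYdd C) (inversionAlpha C ι hι) (mem_PiYdd_iff_of_piYddCharacteristic C hchar _))
        (ContH1.comap D.toTheta D.DeltaTheta C.Huu.subtype continuous_subtype_val
          (map_subtype_piYdd_inf_le_GtpYdd C ⊤) E.etaDd) =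
      ContH1.conj (phi C) D.DeltaTheta ε
        (ContH1.comap D.toTheta D.DeltaTheta C.Huu.subtype continuous_subtype_val
          (map_subtype_piYdd_inf_le_GtpYdd C ⊤) E.etaDd))
    -- the [EtTh] §1 named facts (no `hL`)
    (hO : D.IsEtThOrigin) (h15 : ThetaSetting.Prop15iii E hC) (h15ii : ThetaSetting.Prop15ii E.toKummerData hC) :
    Prop22_ii' Dec :=
  prop22_ii'_model_of_hinv_of_prop15 C ι hι hinv hΔ hq hC hS hchar S eS hl Dec ε hε₁ hε₂ δ hιι h14iota hO h15 h15ii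
    (E.logUdd_zpow_mem_Fdd2_imp hC hO h15 h15ii)

include hinv in
/-- **IUTchII:Prop2.2(ii)′ at the model on the NAMED-FACT route, for `ι` OVER `G_K`, binder `hL` discharged** (kurims
p. 66; [IUTchII] Rmk. 1.4.1 (ii) «over `G_k`»): as `prop22_ii'_model_of_hinv_of_prop15_of_origin` with
`hΔ : ι(Δ^tp_X) = Δ^tp_X` DISCHARGED from «`aug (ι x) = a·aug(x)·a⁻¹`» (abc-iut-w4-d014's
`ThetaSetting.map_deltaTemp_eq_of_aug_conj`). Residual binders on this route: model inputs; the ι-datum {`ι`, `hι`,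
`a`/`haug`, `hq`, `δ`/`hιι`, `hinv`}; `ε` with `h14iota`; the named facts F-2498 / F-0591 / F-2503 — nothing else.
[claim: Mochizuki2012, status: disputed] (IUTchII §2 Prop 2.2 (ii), kurims pp.65-67) -/
theorem prop22_ii'_model_of_hinv_over_of_prop15_of_origin (a : GQp p)
    (haug : ∀ x : D.PiTemp, D.aug (ι x) = a * D.aug x * a⁻¹) (hq : IsQuotientMap D.toTheta)
    [hN : (PiYdd C).Normal] [hYN : D.GtpYdd.Normal] (hC : D.Compat) (hS : D.Sec2Hyps)
    (hchar : PiYddCharacteristic C) (S : BadPlaceSetting.{0}) (eS : (Pi C) ≃ₜ* S.PiX) (hl : S.l = l)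
    {T₀ : TemperedCoverings S (Pi C)}
    (Dec : SubgraphDecomposition S T₀ (etaleThetaDataOfSetting' C hC hS hchar S.toThetaSetting eS hl))
    (ε : Pi C) (hε₁ : (ε : D.PiTemp) ∈ D.GtpY) (hε₂ : (ε : D.PiTemp) ∉ D.GtpYdd)
    (δ : Pi C) (hιι : ∀ x : Pi C, ι (ι (x : D.PiTemp)) = (δ : D.PiTemp) * (x : D.PiTemp) * (δ : D.PiTemp)⁻¹)
    (h14iota : ContH1Aut.autMap (phi C) D.DeltaTheta (inversionAlpha C ι hι)
        (D.thetaCompanionOfAut ι (D.map_deltaTemp_eq_of_aug_conj ι a haug) hq).thetaIso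
        (thetaCompanion_phi C ι hι (D.thetaCompanionOfAut ι (D.map_deltaTemp_eq_of_aug_conj ι a haug) hq))
        (thetaCompanion_mem_deltaTheta ι (D.thetaCompanionOfAut ι (D.map_deltaTemp_eq_of_aug_conj ι a haug) hq))
        (symm_mem_inf_top (PiYdd C) (inversionAlpha C ι hι) (mem_PiYdd_iff_of_piYddCharacteristic C hchar _))
        (ContH1.comap D.toTheta D.DeltaTheta C.Huu.subtype continuous_subtype_val
          (map_subtype_piYdd_inf_le_GtpYdd C ⊤) E.etaDd) =
      ContH1.conj (phi C) D.DeltaTheta ε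
        (ContH1.comap D.toTheta D.DeltaTheta C.Huu.subtype continuous_subtype_val
          (map_subtype_piYdd_inf_le_GtpYdd C ⊤) E.etaDd))
    (hO : D.IsEtThOrigin) (h15 : ThetaSetting.Prop15iii E hC) (h15ii : ThetaSetting.Prop15ii E.toKummerData hC) :
    Prop22_ii' Dec :=
  prop22_ii'_model_of_hinv_over_of_prop15 C ι hι hinv a haug hq hC hS hchar S eS hl Dec ε hε₁ hε₂ δ hιι h14iota hO
    h15 h15ii (E.logUdd_zpow_mem_Fdd2_imp hC hO h15 h15ii)

include hinv in
/-- **IUTchII:Prop2.2(ii)′ at the model on the NAMED-FACT route, for an ARBITRARY topological automorphism `ι`, with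
`hΔ` BY NAME from [AbsAnab] Lem. 1.3.8, binder `hL` discharged** (FACT-LIST F-0007 `FundamentalExtension.PreservesGeom`,
bound at a fundamental extension `(F, eF)` modelling `Π_X ↠ G_K` — abc-iut-w4-d014's
`ThetaSetting.map_deltaTemp_eq_of_preservesGeom`); otherwise as `prop22_ii'_model_of_hinv_of_prop15_of_origin`.
[claim: Mochizuki2012, status: disputed] (IUTchII §2 Prop 2.2 (ii), kurims pp.65-67) -/
theorem prop22_ii'_model_of_hinv_of_preservesGeom_of_prop15_of_origin (F : FundamentalExtension.{0})
    (eF : F.arith ≃ₜ* D.PiHat) (heF : F.geom.map eF.toMulEquiv.toMonoidHom = D.DeltaHat)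
    (h138 : FundamentalExtension.PreservesGeom (F := F)
      (eF.trans ((D.toTemperedCurve.completionAut ι).trans eF.symm)))
    (hq : IsQuotientMap D.toTheta)
    [hN : (PiYdd C).Normal] [hYN : D.GtpYdd.Normal] (hC : D.Compat) (hS : D.Sec2Hyps)
    (hchar : PiYddCharacteristic C) (S : BadPlaceSetting.{0}) (eS : (Pi C) ≃ₜ* S.PiX) (hl : S.l = l)
    {T₀ : TemperedCoverings S (Pi C)}
    (Dec : SubgraphDecomposition S T₀ (etaleThetaDataOfSetting' C hC hS hchar S.toThetaSetting eS hl))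
    (ε : Pi C) (hε₁ : (ε : D.PiTemp) ∈ D.GtpY) (hε₂ : (ε : D.PiTemp) ∉ D.GtpYdd)
    (δ : Pi C) (hιι : ∀ x : Pi C, ι (ι (x : D.PiTemp)) = (δ : D.PiTemp) * (x : D.PiTemp) * (δ : D.PiTemp)⁻¹)
    (h14iota : ContH1Aut.autMap (phi C) D.DeltaTheta (inversionAlpha C ι hι)
        (D.thetaCompanionOfAut ι (D.map_deltaTemp_eq_of_preservesGeom ι F eF heF h138) hq).thetaIso
        (thetaCompanion_phi C ι hι (D.thetaCompanionOfAut ι (D.map_deltaTemp_eq_of_preservesGeom ι F eF heF h138) hq))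
        (thetaCompanion_mem_deltaTheta ι
          (D.thetaCompanionOfAut ι (D.map_deltaTemp_eq_of_preservesGeom ι F eF heF h138) hq))
        (symm_mem_inf_top (PiYdd C) (inversionAlpha C ι hι) (mem_PiYdd_iff_of_piYddCharacteristic C hchar _))
        (ContH1.comap D.toTheta D.DeltaTheta C.Huu.subtype continuous_subtype_val
          (map_subtype_piYdd_inf_le_GtpYdd C ⊤) E.etaDd) =
      ContH1.conj (phi C) D.DeltaTheta ε
        (ContH1.comap D.toTheta D.DeltaTheta C.Huu.subtype continuous_subtype_val
          (map_subtype_piYdd_inf_le_GtpYdd C ⊤) E.etaDd))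
    (hO : D.IsEtThOrigin) (h15 : ThetaSetting.Prop15iii E hC) (h15ii : ThetaSetting.Prop15ii E.toKummerData hC) :
    Prop22_ii' Dec :=
  prop22_ii'_model_of_hinv_of_preservesGeom_of_prop15 C ι hι hinv F eF heF h138 hq hC hS hchar S eS hl Dec ε hε₁ hε₂
    δ hιι h14iota hO h15 h15ii (E.logUdd_zpow_mem_Fdd2_imp hC hO h15 h15ii)

end Inversion

end EtaleThetaDataOfSetting

end

end Literature.IUT.HodgeArakelov
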